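import Summits.AtomisticToContinuum.Crystallization.Theorems.HullExactificationCascadeHullGoodEverywhereDefs

/-!
# `HullGoodEverywhere` (route `HullExactificationCascade`, item D): API of the goodness predicate

Unbundling of `PatternGood P R₀ S y` (see `…HullGoodEverywhereDefs`) for a `δ`-separated `S` and
a pattern `P` of unit vectors: the local scale `d = dist(y, S ∖ {y})` lies in `[δ, R₀]`, the
shell consists of the `|P|` labelled neighbours `q v`, `v ∈ P`, at distances in
`[19d/20, 21d/20]`, one of them AT distance `d`, every other point of `S` is at distance
`≥ 13d/10`, and `d⁻¹ (q v - y)` is within `1/20` of `A v` (`PatternGood.exists_data`); conversely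
such data give `PatternGood` (`patternGood_of_data`).  Consequences: translation invariance
(`PatternGood.translate`, `SiteGood.translate`) and the passage `SiteGood ↔ PatternGood fcc ∨ hcp`.
-/

noncomputable section

namespace Summit.AtomisticToContinuum.Crystallization.Theorems

open Literature.MathematicalPhysics.StatisticalMechanics Literature.Geometry.DiscreteGeometry
open Filter Topology Metric

/-! ## The local scale `dist(y, S ∖ {y})` -/

/-- The set of distances from `y` to the other points of `S` is bounded below (by `0`).
[folklore] -/
theorem hge_bddBelow_dists (S : Set (EuclideanSpace ℝ (Fin 3))) (y : (EuclideanSpace ℝ (Fin 3))) : BddBelow ((fun z => dist z y) '' (S \ {y})) :=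
  ⟨0, by rintro _ ⟨z, -, rfl⟩; exact dist_nonneg⟩

/-- `dist(y, S ∖ {y}) ≤ dist z y` for every `z ∈ S`, `z ≠ y`. [folklore] -/
theorem hge_sInf_le_dist {S : Set (EuclideanSpace ℝ (Fin 3))} {y z : (EuclideanSpace ℝ (Fin 3))} (hz : z ∈ S) (hzy : z ≠ y) :
    sInf ((fun z => dist z y) '' (S \ {y})) ≤ dist z y :=
  csInf_le (hge_bddBelow_dists S y) ⟨z, ⟨hz, hzy⟩, rfl⟩

/-- A lower bound for all the distances from `y` to the other points of `S` bounds
`dist(y, S ∖ {y})` from below, provided `S ∖ {y}` is non-empty. [folklore] -/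
theorem hge_le_sInf_dists {S : Set (EuclideanSpace ℝ (Fin 3))} {y : (EuclideanSpace ℝ (Fin 3))} {δ : ℝ} (hne : (S \ {y}).Nonempty)
    (h : ∀ z ∈ S, z ≠ y → δ ≤ dist z y) : δ ≤ sInf ((fun z => dist z y) '' (S \ {y})) :=
  le_csInf (hne.image _) (by rintro _ ⟨z, ⟨hz, hzy⟩, rfl⟩; exact h z hz hzy)

/-- If the distance `d > 0` is attained and is a lower bound, it is the local scale. [folklore] -/
theorem hge_sInf_dists_eq {S : Set (EuclideanSpace ℝ (Fin 3))} {y : (EuclideanSpace ℝ (Fin 3))} {d : ℝ} {z₀ : (EuclideanSpace ℝ (Fin 3))} (hz₀ : z₀ ∈ S) (hz₀y : z₀ ≠ y)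
    (hz₀d : dist z₀ y = d) (h : ∀ z ∈ S, z ≠ y → d ≤ dist z y) :
    sInf ((fun z => dist z y) '' (S \ {y})) = d :=
  le_antisymm (hz₀d ▸ hge_sInf_le_dist hz₀ hz₀y) (hge_le_sInf_dists ⟨z₀, hz₀, hz₀y⟩ h)

/-! ## Radial pinning -/

/-- **Annulus.** If `d > 0`, `‖w‖ = 1` and `d⁻¹ u` is within `1/20` of `w`, then
`19d/20 ≤ ‖u‖ ≤ 21d/20`. [folklore] -/
theorem hge_annulus {d : ℝ} (hd : 0 < d) {u w : (EuclideanSpace ℝ (Fin 3))} (hw : ‖w‖ = 1)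
    (h : dist (d⁻¹ • u) w ≤ 1 / 20) : 19 / 20 * d ≤ ‖u‖ ∧ ‖u‖ ≤ 21 / 20 * d := by
  have h1 : |‖d⁻¹ • u‖ - ‖w‖| ≤ 1 / 20 := (abs_norm_sub_norm_le _ _).trans (by rwa [← dist_eq_norm])
  rw [hw, norm_smul, norm_inv, Real.norm_of_nonneg hd.le, abs_le] at h1
  obtain ⟨h2, h3⟩ := h1
  have e : d * (d⁻¹ * ‖u‖) = ‖u‖ := by field_simp
  constructor
  · have := mul_le_mul_of_nonneg_left (by linarith : 19 / 20 ≤ d⁻¹ * ‖u‖) hd.le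
    linarith
  · have := mul_le_mul_of_nonneg_left (by linarith : d⁻¹ * ‖u‖ ≤ 21 / 20) hd.le
    linarith

/-! ## Unbundling `PatternGood` -/

/-- **Data of a good site.** Let `S` be `δ`-separated (`δ > 0`), `y ∈ S`, and `P` a non-empty
pattern of unit vectors with `PatternGood P R₀ S y`.  Then with `d := dist(y, S ∖ {y})` there are
a linear isometry `A` and labelled neighbours `q : P → ℝ³` such that: `δ ≤ d ≤ R₀`; each `q v`
lies in `S ∖ {y}` at distance `< 13d/10` (indeed in `[19d/20, 21d/20]`) from `y` with
`dist (d⁻¹ (q v - y)) (A v) ≤ 1/20`; `q` is injective and exhausts the points of `S ∖ {y}` within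
`13d/10`; every point of `S ∖ {y}` is at distance `≥ d`, and some `q v` is at distance exactly
`d`. [folklore] -/
theorem PatternGood.exists_data {P : Finset (EuclideanSpace ℝ (Fin 3))} {R₀ : ℝ} {S : Set (EuclideanSpace ℝ (Fin 3))} {y : (EuclideanSpace ℝ (Fin 3))} {δ : ℝ}
    (hδ : 0 < δ) (hP1 : ∀ v ∈ P, ‖v‖ = 1) (hPne : P.Nonempty)
    (hsep : ∀ p ∈ S, ∀ q ∈ S, p ≠ q → δ ≤ dist p q) (hy : y ∈ S) (h : PatternGood P R₀ S y) :
    ∃ (d : ℝ) (A : (EuclideanSpace ℝ (Fin 3)) →ₗᵢ[ℝ] (EuclideanSpace ℝ (Fin 3))) (q : ↥P → (EuclideanSpace ℝ (Fin 3))),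
      sInf ((fun z => dist z y) '' (S \ {y})) = d ∧ δ ≤ d ∧ d ≤ R₀ ∧
      (∀ v, q v ∈ S ∧ q v ≠ y ∧ dist (q v) y < 13 / 10 * d ∧
        dist (d⁻¹ • (q v - y)) (A (v : (EuclideanSpace ℝ (Fin 3)))) ≤ 1 / 20 ∧
        19 / 20 * d ≤ dist (q v) y ∧ dist (q v) y ≤ 21 / 20 * d) ∧
      Function.Injective q ∧
      (∀ z ∈ S, z ≠ y → dist z y < 13 / 10 * d → ∃ v, q v = z) ∧
      (∀ z ∈ S, z ≠ y → d ≤ dist z y) ∧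
      (∃ v, dist (q v) y = d) := by
  classical
  obtain ⟨d, hd⟩ : ∃ d : ℝ, sInf ((fun z => dist z y) '' (S \ {y})) = d := ⟨_, rfl⟩
  simp only [PatternGood] at h
  rw [hd] at h
  obtain ⟨hdR, A, e, he⟩ := h
  generalize hT : ({z : (EuclideanSpace ℝ (Fin 3)) | z ∈ S ∧ z ≠ y ∧ dist z y < 13 / 10 * d} : Set (EuclideanSpace ℝ (Fin 3))) = T at e he
  have hmemT : ∀ {z : (EuclideanSpace ℝ (Fin 3))}, z ∈ T ↔ z ∈ S ∧ z ≠ y ∧ dist z y < 13 / 10 * d := fun {z} => by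
    rw [← hT]; rfl
  -- labelled neighbours
  set q : ↥P → (EuclideanSpace ℝ (Fin 3)) := fun v => ((e.symm v : ↥T) : (EuclideanSpace ℝ (Fin 3))) with hq_def
  have hqT : ∀ v, q v ∈ S ∧ q v ≠ y ∧ dist (q v) y < 13 / 10 * d := fun v => hmemT.1 (e.symm v).2
  have hqe : ∀ v, e (e.symm v) = v := fun v => Equiv.apply_symm_apply _ _
  have hqA : ∀ v, dist (d⁻¹ • (q v - y)) (A (v : (EuclideanSpace ℝ (Fin 3)))) ≤ 1 / 20 := fun v => by
    have := he (e.symm v)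
    rwa [hqe v] at this
  -- the scale is positive: `S ∖ {y}` contains `q v₀`
  obtain ⟨v₀, hv₀⟩ := hPne
  have hne : (S \ {y}).Nonempty := ⟨q ⟨v₀, hv₀⟩, (hqT _).1, (hqT _).2.1⟩
  have hdle : ∀ z ∈ S, z ≠ y → d ≤ dist z y := fun z hz hzy => hd ▸ hge_sInf_le_dist hz hzy
  have hδd : δ ≤ d := by
    have key : δ ≤ sInf ((fun z => dist z y) '' (S \ {y})) :=
      hge_le_sInf_dists hne fun z hz hzy => by rw [dist_comm]; exact hsep y hy z hz hzy.symm
    rwa [hd] at key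
  have hd0 : 0 < d := hδ.trans_le hδd
  have hann : ∀ v, 19 / 20 * d ≤ dist (q v) y ∧ dist (q v) y ≤ 21 / 20 * d := fun v => by
    have := hge_annulus hd0 (by rw [A.norm_map, hP1 _ v.2]) (hqA v)
    rwa [← dist_eq_norm] at this
  have hinj : Function.Injective q := fun v w hvw => by
    have : (e.symm v : ↥T) = e.symm w := Subtype.ext hvw
    exact e.symm.injective this
  have hsurj : ∀ z ∈ S, z ≠ y → dist z y < 13 / 10 * d → ∃ v, q v = z := fun z hz hzy hlt => by
    refine ⟨e ⟨z, hmemT.2 ⟨hz, hzy, hlt⟩⟩, ?_⟩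
    simp only [hq_def, Equiv.symm_apply_apply]
  -- the minimum over the shell is the scale
  obtain ⟨vm, -, hvm⟩ := Finset.exists_min_image Finset.univ (fun v : ↥P => dist (q v) y)
    ⟨⟨v₀, hv₀⟩, Finset.mem_univ _⟩
  have hmin : dist (q vm) y = d := by
    refine le_antisymm ?_ (hdle _ (hqT vm).1 (hqT vm).2.1)
    by_contra hlt
    rw [not_le] at hlt
    -- every other point is at distance ≥ min (dist (q vm) y) (13d/10) > d
    have hlow : min (dist (q vm) y) (13 / 10 * d) ≤ d := by
      have key : min (dist (q vm) y) (13 / 10 * d) ≤ sInf ((fun z => dist z y) '' (S \ {y})) := by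
        refine hge_le_sInf_dists hne fun z hz hzy => ?_
        by_cases hzT : dist z y < 13 / 10 * d
        · obtain ⟨v, rfl⟩ := hsurj z hz hzy hzT
          exact (min_le_left _ _).trans (hvm v (Finset.mem_univ _))
        · exact (min_le_right _ _).trans (not_lt.1 hzT)
      rwa [hd] at key
    rcases min_le_iff.1 hlow with h1 | h1 <;> linarith
  exact ⟨d, A, q, hd, hδd, hdR, fun v => ⟨(hqT v).1, (hqT v).2.1, (hqT v).2.2, hqA v, hann v⟩,
    hinj, hsurj, hdle, ⟨vm, hmin⟩⟩

/-- **Rebundling.** Conversely, labelled data as in `PatternGood.exists_data` give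
`PatternGood P R₀ S y`: the bijection of the shell with `P` is the inverse of `v ↦ q v`.
[folklore] -/
theorem patternGood_of_data {P : Finset (EuclideanSpace ℝ (Fin 3))} {R₀ : ℝ} {S : Set (EuclideanSpace ℝ (Fin 3))} {y : (EuclideanSpace ℝ (Fin 3))} (d : ℝ)
    (A : (EuclideanSpace ℝ (Fin 3)) →ₗᵢ[ℝ] (EuclideanSpace ℝ (Fin 3))) (q : ↥P → (EuclideanSpace ℝ (Fin 3))) (hdR : d ≤ R₀)
    (hqS : ∀ v, q v ∈ S) (hqy : ∀ v, q v ≠ y) (hqlt : ∀ v, dist (q v) y < 13 / 10 * d)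
    (hqA : ∀ v, dist (d⁻¹ • (q v - y)) (A (v : (EuclideanSpace ℝ (Fin 3)))) ≤ 1 / 20) (hinj : Function.Injective q)
    (hsurj : ∀ z ∈ S, z ≠ y → dist z y < 13 / 10 * d → ∃ v, q v = z)
    (hmin : ∃ v, dist (q v) y = d) (hle : ∀ z ∈ S, z ≠ y → d ≤ dist z y) :
    PatternGood P R₀ S y := by
  obtain ⟨vm, hvm⟩ := hmin
  have hsInf : sInf ((fun z => dist z y) '' (S \ {y})) = d :=
    hge_sInf_dists_eq (hqS vm) (hqy vm) hvm hle
  simp only [PatternGood]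
  rw [hsInf]
  refine ⟨hdR, A, ?_⟩
  set T : Set (EuclideanSpace ℝ (Fin 3)) := {z : (EuclideanSpace ℝ (Fin 3)) | z ∈ S ∧ z ≠ y ∧ dist z y < 13 / 10 * d} with hT_def
  set f : ↥P → ↥T := fun v => ⟨q v, hqS v, hqy v, hqlt v⟩ with hf_def
  have hfb : Function.Bijective f := by
    refine ⟨fun v w hvw => hinj (congrArg Subtype.val hvw), fun t => ?_⟩
    obtain ⟨v, hv⟩ := hsurj t.1 t.2.1 t.2.2.1 t.2.2.2
    exact ⟨v, Subtype.ext hv⟩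
  refine ⟨(Equiv.ofBijective f hfb).symm, fun t => ?_⟩
  obtain ⟨v, hv⟩ := hfb.2 t
  have hsv : (Equiv.ofBijective f hfb).symm t = v := by
    rw [Equiv.symm_apply_eq, Equiv.ofBijective_apply]
    exact hv.symm
  have htv : (t : (EuclideanSpace ℝ (Fin 3))) = q v := by
    rw [← hv]
  rw [hsv, htv]
  exact hqA v

/-! ## Translation invariance -/

/-- `PatternGood` is invariant under translations of the pair `(S, y)`. [folklore] -/
theorem PatternGood.translate {P : Finset (EuclideanSpace ℝ (Fin 3))} {R₀ : ℝ} {S : Set (EuclideanSpace ℝ (Fin 3))} {y : (EuclideanSpace ℝ (Fin 3))} {δ : ℝ}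
    (hδ : 0 < δ) (hP1 : ∀ v ∈ P, ‖v‖ = 1) (hPne : P.Nonempty)
    (hsep : ∀ p ∈ S, ∀ q ∈ S, p ≠ q → δ ≤ dist p q) (hy : y ∈ S) (h : PatternGood P R₀ S y)
    (c : (EuclideanSpace ℝ (Fin 3))) : PatternGood P R₀ ((fun z => z + c) '' S) (y + c) := by
  obtain ⟨d, A, q, -, -, hdR, hq, hinj, hsurj, hle, ⟨vm, hvm⟩⟩ :=
    h.exists_data hδ hP1 hPne hsep hy
  refine patternGood_of_data d A (fun v => q v + c) hdR (fun v => Set.mem_image_of_mem _ (hq v).1)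
    (fun v heq => (hq v).2.1 (add_right_cancel heq)) (fun v => ?_) (fun v => ?_)
    (fun v w hvw => hinj (add_right_cancel hvw)) ?_ ⟨vm, by rw [dist_add_right, hvm]⟩ ?_
  · rw [dist_add_right]; exact (hq v).2.2.1
  · rw [add_sub_add_right_eq_sub]; exact (hq v).2.2.2.1
  · rintro _ ⟨z, hz, rfl⟩ hzy hlt
    rw [dist_add_right] at hlt
    obtain ⟨v, rfl⟩ := hsurj z hz (fun h => hzy (by rw [h])) hlt
    exact ⟨v, rfl⟩
  · rintro _ ⟨z, hz, rfl⟩ hzy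
    rw [dist_add_right]
    exact hle z hz fun h => hzy (by rw [h])

/-- The two patterns consist of unit vectors and are non-empty (twelve points each). [folklore] -/
theorem hge_patterns_unit_nonempty :
    ((∀ v ∈ fccKissingPattern, ‖v‖ = 1) ∧ fccKissingPattern.Nonempty) ∧
      ((∀ v ∈ hcpKissingPattern, ‖v‖ = 1) ∧ hcpKissingPattern.Nonempty) := by
  refine ⟨⟨fun v hv => norm_eq_one_of_mem_fccKissingPattern hv, ?_⟩,
    ⟨fun v hv => norm_eq_one_of_mem_hcpKissingPattern hv, ?_⟩⟩
  · rw [← Finset.card_pos, card_fccKissingPattern]; norm_num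
  · rw [← Finset.card_pos, card_hcpKissingPattern]; norm_num

/-- `SiteGood` from `PatternGood` for either pattern. [folklore] -/
theorem PatternGood.siteGood {R₀ : ℝ} {S : Set (EuclideanSpace ℝ (Fin 3))} {y : (EuclideanSpace ℝ (Fin 3))}
    (h : PatternGood fccKissingPattern R₀ S y ∨ PatternGood hcpKissingPattern R₀ S y) :
    SiteGood S y := by
  rcases h with h | h
  · exact (siteGood_iff_patternGood h.1).2 (Or.inl h)
  · exact (siteGood_iff_patternGood h.1).2 (Or.inr h)

/-- `PatternGood` (for one of the two patterns) from `SiteGood` and a neighbour within `R₀`.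
[folklore] -/
theorem SiteGood.patternGood {R₀ : ℝ} {S : Set (EuclideanSpace ℝ (Fin 3))} {y : (EuclideanSpace ℝ (Fin 3))} (h : SiteGood S y)
    (hb : ∃ z ∈ S, z ≠ y ∧ dist z y ≤ R₀) :
    PatternGood fccKissingPattern R₀ S y ∨ PatternGood hcpKissingPattern R₀ S y := by
  obtain ⟨z, hz, hzy, hzR⟩ := hb
  exact (siteGood_iff_patternGood ((hge_sInf_le_dist hz hzy).trans hzR)).1 h

/-- `SiteGood` is invariant under translations of the pair `(S, y)`, for `δ`-separated `S ∋ y`.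
[folklore] -/
theorem SiteGood.translate {S : Set (EuclideanSpace ℝ (Fin 3))} {y : (EuclideanSpace ℝ (Fin 3))} {δ : ℝ} (hδ : 0 < δ)
    (hsep : ∀ p ∈ S, ∀ q ∈ S, p ≠ q → δ ≤ dist p q) (hy : y ∈ S) (h : SiteGood S y) (c : (EuclideanSpace ℝ (Fin 3))) :
    SiteGood ((fun z => z + c) '' S) (y + c) := by
  have h' := (siteGood_iff_patternGood le_rfl).1 h
  obtain ⟨⟨hf1, hfne⟩, ⟨hh1, hhne⟩⟩ := hge_patterns_unit_nonempty
  rcases h' with h' | h'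
  · exact PatternGood.siteGood (Or.inl (h'.translate hδ hf1 hfne hsep hy c))
  · exact PatternGood.siteGood (Or.inr (h'.translate hδ hh1 hhne hsep hy c))

/-- For a finite configuration `x` and a vector `c`, the translated configuration has range
`(· + c) '' range x`. [folklore] -/
theorem hge_range_add_const {N : ℕ} (x : Fin N → (EuclideanSpace ℝ (Fin 3))) (c : (EuclideanSpace ℝ (Fin 3))) :
    Set.range (fun i => x i + c) = (fun z => z + c) '' Set.range x := by
  ext z
  simp only [Set.mem_range, Set.mem_image, exists_exists_eq_and]

end Summit.AtomisticToContinuum.Crystallization.Theorems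

end
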